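import Summits.PneNP.PneNP.Theorems.KarlinRubinMonotoneBlindSwitchComplete

/-!
# Route KarlinRubin, crux `MonotoneBlind` (stmt-PneNP-18027): clique-restriction switching — resampling and codes

Third file of the clique-restriction switching lemma (seat write-up `MonotoneBlind_AC0_announce.md`): the two
ingredients of the Razborov–Beame count. For a clause list `l` and parameters `P r v₀`:

* `switch_resample_le` — resampling the inside of `V₁`: the inputs on which the forward process succeeds with some
  code are at most `2^{C(v₀-1,2)+r}` times those on which it succeeds AND the final queried set is white (the process
  reads only the slots not inside `V₁`; whitening the `≤ C(v₀-1,2)+r` queried slots is `2^{…}`-to-one);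
* `switch_card_codes_dec_le` — for a fixed input, the codes of length `≤ M` accepted by the DECODER number at most
  `(2 (P+1)^{2r})^M` (at each stage the entry names two subsets of size `≤ r` of a clause with `≤ P` slots);
(The count itself — vertex containment and assembly — is the next file, `…SwitchCount.lean`.)

All `--supports stmt-PneNP-18027`; no new definitions (the code space is an abbreviation-free `Finset` expression).
-/

set_option linter.dupNamespace false -- `Summit.PneNP.PneNP.…`: summit = sub-problem (D-0017)

namespace Summit.PneNP.PneNP.Theorems

open Finset
open Literature.Computability.Complexity
open Literature.Probability.RandomGraphs.PlantedClique

variable {n : ℕ}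

/-! ### Resampling the inside of the sub-universe -/

open Classical in
/-- The forward process reads `x` only off the inside of `V`. [folklore] -/
theorem swFwd_congr_outside (V : Finset (Fin n)) {x x' : EdgeVec n} (P r v₀ : ℕ)
    (h : ∀ e : (⊤ : SimpleGraph (Fin n)).edgeSet, (¬ ∀ v ∈ (e : Sym2 (Fin n)), v ∈ V) → x' e = x e) :
    ∀ (code : List (Finset (⊤ : SimpleGraph (Fin n)).edgeSet × Finset (⊤ : SimpleGraph (Fin n)).edgeSet))
      (l : List (Finset (⊤ : SimpleGraph (Fin n)).edgeSet)) (K B : Finset (⊤ : SimpleGraph (Fin n)).edgeSet)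
      (Z : Finset (Fin n)), swFwd V x' P r v₀ code l K B Z = swFwd V x P r v₀ code l K B Z := by
  intro code l
  induction l generalizing code with
  | nil => intros; simp
  | cons S l ih =>
    intro K B Z
    have h1iff : (∃ e ∈ S, (¬ ∀ v ∈ (e : Sym2 (Fin n)), v ∈ V) ∧ x' e = true) ↔
        ∃ e ∈ S, (¬ ∀ v ∈ (e : Sym2 (Fin n)), v ∈ V) ∧ x e = true := by
      refine exists_congr fun e => and_congr_right fun _ => ?_
      refine ⟨fun ⟨he1, he2⟩ => ⟨he1, by rw [← h e he1]; exact he2⟩, fun ⟨he1, he2⟩ => ⟨he1, by rw [h e he1]; exact he2⟩⟩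
    rw [swFwd_cons, swFwd_cons]
    by_cases h1 : ∃ e ∈ S, (¬ ∀ v ∈ (e : Sym2 (Fin n)), v ∈ V) ∧ x e = true
    · rw [if_pos (h1iff.2 h1), if_pos h1, ih]
    rw [if_neg (fun h' => h1 (h1iff.1 h')), if_neg h1]
    by_cases h2 : ∃ e ∈ S, e ∈ B
    · rw [if_pos h2, if_pos h2, ih]
    rw [if_neg h2, if_neg h2]
    match code with
    | [] => rfl
    | (nw, bk) :: code' =>
      simp only [ih]

open Classical in
/-- **Resampling.** With `R = C(v₀-1,2) + r`: the inputs on which the forward process (from the empty state) succeeds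
are at most `2^R` times those on which it succeeds with the final queried set all white. [folklore] -/
theorem switch_resample_le (V : Finset (Fin n)) (P r v₀ : ℕ) (hv₀ : 0 < v₀)
    (code : List (Finset (⊤ : SimpleGraph (Fin n)).edgeSet × Finset (⊤ : SimpleGraph (Fin n)).edgeSet))
    (l : List (Finset (⊤ : SimpleGraph (Fin n)).edgeSet)) :
    #(univ.filter fun x : EdgeVec n => (swFwd V x P r v₀ code l ∅ ∅ ∅).isSome = true) ≤
      2 ^ ((v₀ - 1).choose 2 + r) * #(univ.filter fun x : EdgeVec n =>
        ∃ Zf : Finset (Fin n), ∃ F : Finset (⊤ : SimpleGraph (Fin n)).edgeSet,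
          swFwd V x P r v₀ code l ∅ ∅ ∅ = some (Zf, F) ∧ ∀ e ∈ F, x e = false) := by
  set Sx := univ.filter fun x : EdgeVec n => (swFwd V x P r v₀ code l ∅ ∅ ∅).isSome = true with hSx
  set Tx := univ.filter fun x : EdgeVec n =>
    ∃ Zf : Finset (Fin n), ∃ F : Finset (⊤ : SimpleGraph (Fin n)).edgeSet,
      swFwd V x P r v₀ code l ∅ ∅ ∅ = some (Zf, F) ∧ ∀ e ∈ F, x e = false with hTx
  -- whitening the final queried set
  let Fof : EdgeVec n → Finset (⊤ : SimpleGraph (Fin n)).edgeSet := fun x =>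
    match swFwd V x P r v₀ code l ∅ ∅ ∅ with
    | some (_, F) => F
    | none => ∅
  let ψ : EdgeVec n → EdgeVec n := fun x e => if e ∈ Fof x then false else x e
  have hsound : ∀ x Zf F, swFwd V x P r v₀ code l ∅ ∅ ∅ = some (Zf, F) →
      (∀ e ∈ F, ∀ v ∈ (e : Sym2 (Fin n)), v ∈ V) ∧ #F ≤ (v₀ - 1).choose 2 + r := by
    intro x Zf F h
    have hs := swFwd_sound V x P r v₀ code l ∅ ∅ ∅ Zf F (by simp) (empty_subset _) (by simpa using hv₀) h
    exact ⟨hs.2.2.1, hs.2.2.2⟩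
  have hψrun : ∀ x ∈ Sx, swFwd V (ψ x) P r v₀ code l ∅ ∅ ∅ = swFwd V x P r v₀ code l ∅ ∅ ∅ := by
    intro x hx
    rw [hSx, mem_filter] at hx
    obtain ⟨p, hp⟩ := Option.isSome_iff_exists.1 hx.2
    obtain ⟨Zf, F⟩ := p
    refine swFwd_congr_outside V P r v₀ (fun e he => ?_) code l ∅ ∅ ∅
    have hFof : Fof x = F := by simp only [Fof, hp]
    simp only [ψ, hFof]
    rw [if_neg]
    exact fun heF => he ((hsound x Zf F hp).1 e heF)
  have hmaps : ∀ x ∈ Sx, ψ x ∈ Tx := by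
    intro x hx
    have hrun := hψrun x hx
    rw [hSx, mem_filter] at hx
    obtain ⟨p, hp⟩ := Option.isSome_iff_exists.1 hx.2
    obtain ⟨Zf, F⟩ := p
    have hFof : Fof x = F := by simp only [Fof, hp]
    rw [hTx, mem_filter]
    refine ⟨mem_univ _, Zf, F, by rw [hrun, hp], fun e he => ?_⟩
    simp only [ψ, hFof]
    rw [if_pos he]
  refine (card_le_mul_card_image_of_maps_to hmaps (2 ^ ((v₀ - 1).choose 2 + r)) fun w hw => ?_)
  -- the fibre of `ψ` over `w`: inputs agreeing with `w` off `F_w`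
  rw [hTx, mem_filter] at hw
  obtain ⟨-, Zf, F, hwF, -⟩ := hw
  calc #(Sx.filter fun x => ψ x = w)
      ≤ #(univ.filter fun x : EdgeVec n => ∀ e, e ∉ F → x e = w e) := by
        refine card_le_card fun x hx => ?_
        rw [mem_filter] at hx
        obtain ⟨hxS, hψx⟩ := hx
        have hrun := hψrun x hxS
        rw [hψx, hwF] at hrun
        have hFof : Fof x = F := by simp only [Fof, ← hrun]
        rw [mem_filter]
        refine ⟨mem_univ _, fun e he => ?_⟩
        rw [← hψx]
        simp only [ψ, hFof]
        rw [if_neg he]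
    _ ≤ 2 ^ #F := card_filter_eq_off_le F w
    _ ≤ 2 ^ ((v₀ - 1).choose 2 + r) := Nat.pow_le_pow_right two_pos (hsound w Zf F hwF).2

/-! ### Codes accepted by the decoder -/

/-- The lists of entries of length `≤ M`, as a `Finset`. [folklore] -/
theorem mem_codes_iff {α : Type*} [Fintype α] [DecidableEq α] (M : ℕ) (c : List α) :
    c ∈ (range (M + 1)).biUnion (fun m => (univ : Finset (Fin m → α)).image List.ofFn) ↔ c.length ≤ M := by
  simp only [mem_biUnion, mem_range, mem_image, mem_univ, true_and, Nat.lt_succ_iff]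
  constructor
  · rintro ⟨m, hm, f, rfl⟩
    simpa using hm
  · intro hc
    exact ⟨c.length, hc, c.get, List.ofFn_get c⟩

/-- The subsets of size `≤ r` of a finite set `Z` number at most `(#Z+1)^r`. [folklore] -/
theorem switch_card_filter_powersetZ_card_le {α : Type*} [DecidableEq α] (Z : Finset α) (r : ℕ) :
    #(Z.powerset.filter fun T => #T ≤ r) ≤ (#Z + 1) ^ r := by
  have h : (Z.powerset.filter fun T => #T ≤ r) = (range (r + 1)).biUnion fun j => powersetCard j Z := by
    ext T
    simp only [mem_filter, mem_powerset, mem_biUnion, mem_range, mem_powersetCard, Nat.lt_succ_iff]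
    exact ⟨fun ⟨hTZ, hT⟩ => ⟨#T, hT, hTZ, rfl⟩, fun ⟨j, hj, hTZ, hTj⟩ => ⟨hTZ, hTj ▸ hj⟩⟩
  rw [h]
  refine card_biUnion_le.trans ?_
  refine le_trans (sum_le_sum fun j _ => ?_) (switch_sum_range_choose_le_pow #Z r)
  rw [card_powersetCard]

open Classical in
/-- The admissible entries at a stage on a clause with `≤ P` slots number at most `(P+1)^{2r}`. [folklore] -/
theorem switch_card_entries_le (S : Finset (⊤ : SimpleGraph (Fin n)).edgeSet) (P r : ℕ) (hS : #S ≤ P) :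
    #((S.powerset ×ˢ S.powerset).filter fun p : Finset (⊤ : SimpleGraph (Fin n)).edgeSet ×
        Finset (⊤ : SimpleGraph (Fin n)).edgeSet => p.1 ⊆ S ∧ p.2 ⊆ p.1 ∧ #S ≤ P ∧ #p.1 ≤ r) ≤ (P + 1) ^ (2 * r) := by
  calc #((S.powerset ×ˢ S.powerset).filter fun p : Finset (⊤ : SimpleGraph (Fin n)).edgeSet ×
        Finset (⊤ : SimpleGraph (Fin n)).edgeSet => p.1 ⊆ S ∧ p.2 ⊆ p.1 ∧ #S ≤ P ∧ #p.1 ≤ r)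
      ≤ #((S.powerset.filter fun T => #T ≤ r) ×ˢ (S.powerset.filter fun T => #T ≤ r)) := by
        refine card_le_card fun p hp => ?_
        rw [mem_filter, mem_product] at hp
        obtain ⟨⟨h1, h2⟩, hpS, hp21, -, hpr⟩ := hp
        rw [mem_product, mem_filter, mem_filter]
        exact ⟨⟨h1, hpr⟩, mem_powerset.2 (hp21.trans hpS), (card_le_card hp21).trans hpr⟩
    _ ≤ (P + 1) ^ r * (P + 1) ^ r := by
        rw [card_product]
        have h := (switch_card_filter_powersetZ_card_le S r).trans (Nat.pow_le_pow_left (Nat.succ_le_succ hS) r)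
        exact Nat.mul_le_mul h h
    _ = (P + 1) ^ (2 * r) := by rw [← pow_add]; ring_nf

open Classical in
/-- **Codes accepted by the decoder.** For a fixed input and any state, the codes of length `≤ M` on which the
decoder succeeds number at most `(2 (P+1)^{2r})^M`. [cite: Beame1994, §3] -/
theorem switch_card_codes_dec_le (x' : EdgeVec n) (P r v₀ : ℕ) :
    ∀ (l : List (Finset (⊤ : SimpleGraph (Fin n)).edgeSet)) (M : ℕ) (K B : Finset (⊤ : SimpleGraph (Fin n)).edgeSet)
      (Z : Finset (Fin n)),
      #(((range (M + 1)).biUnion fun m => (univ : Finset (Fin m →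
          Finset (⊤ : SimpleGraph (Fin n)).edgeSet × Finset (⊤ : SimpleGraph (Fin n)).edgeSet)).image List.ofFn).filter
        fun c => (swDec x' P r v₀ c l K B Z).isSome = true) ≤ (2 * (P + 1) ^ (2 * r)) ^ M := by
  intro l
  induction l with
  | nil =>
    intro M K B Z
    rw [Finset.card_eq_zero.2]
    · exact Nat.zero_le _
    rw [filter_eq_empty_iff]
    intro c _
    simp
  | cons S l ih =>
    intro M K B Z
    set codes : ℕ → Finset (List (Finset (⊤ : SimpleGraph (Fin n)).edgeSet × Finset (⊤ : SimpleGraph (Fin n)).edgeSet)) :=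
      fun M => (range (M + 1)).biUnion fun m => (univ : Finset (Fin m →
        Finset (⊤ : SimpleGraph (Fin n)).edgeSet × Finset (⊤ : SimpleGraph (Fin n)).edgeSet)).image List.ofFn
      with hcodes
    have hmem : ∀ M c, c ∈ codes M ↔ c.length ≤ M := fun M c => mem_codes_iff M c
    by_cases hskip : ∃ e ∈ S, (e ∉ K ∧ x' e = true) ∨ e ∈ B
    · refine le_trans (le_of_eq ?_) (ih M K B Z)
      congr 1
      refine filter_congr fun c _ => ?_
      rw [swDec_cons, if_pos hskip]
    -- a stage: decompose the accepted codes by their head entry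
    set Adm := (S.powerset ×ˢ S.powerset).filter fun p : Finset (⊤ : SimpleGraph (Fin n)).edgeSet ×
        Finset (⊤ : SimpleGraph (Fin n)).edgeSet => p.1 ⊆ S ∧ p.2 ⊆ p.1 ∧ #S ≤ P ∧ #p.1 ≤ r with hAdm
    cases M with
    | zero =>
      rw [Finset.card_eq_zero.2]
      · exact Nat.zero_le _
      rw [filter_eq_empty_iff]
      intro c hc
      rw [hmem, Nat.le_zero, List.length_eq_zero_iff] at hc
      subst hc
      rw [swDec_cons, if_neg hskip]
      simp
    | succ M =>
      -- cover: accepted codes start with an admissible entry, followed by `[]` or an accepted code for the new state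
      have hcover : ((codes (M + 1)).filter fun c => (swDec x' P r v₀ c (S :: l) K B Z).isSome = true) ⊆
          Adm.biUnion fun p => {[p]} ∪ ((codes M).filter fun c' =>
            (swDec x' P r v₀ c' l (K ∪ p.1) (B ∪ p.2)
              (Z ∪ univ.filter fun v : Fin n => ∃ e ∈ p.1, v ∈ (e : Sym2 (Fin n)))).isSome = true).image
                (fun c' => p :: c') := by
        intro c hc
        rw [mem_filter, hmem] at hc
        obtain ⟨hlen, hsome⟩ := hc
        rw [swDec_cons, if_neg hskip] at hsome
        match c, hlen, hsome with
        | [], _, hsome => simp at hsome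
        | (nw, bk) :: c', hlen, hsome =>
          simp only at hsome
          by_cases h3 : nw ⊆ S ∧ bk ⊆ nw ∧ #S ≤ P ∧ #nw ≤ r
          swap
          · rw [if_neg h3] at hsome; simp at hsome
          rw [if_pos h3] at hsome
          have hadm : (nw, bk) ∈ Adm := by
            rw [hAdm, mem_filter, mem_product, mem_powerset, mem_powerset]
            exact ⟨⟨h3.1, h3.2.1.trans h3.1⟩, h3⟩
          rw [mem_biUnion]
          refine ⟨(nw, bk), hadm, ?_⟩
          rw [mem_union]
          split_ifs at hsome with h4 h5 h6
          · subst h5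
            exact Or.inl (mem_singleton_self _)
          · simp at hsome
          · simp at hsome
          · refine Or.inr (mem_image.2 ⟨c', mem_filter.2 ⟨?_, hsome⟩, rfl⟩)
            rw [hmem]
            simp only [List.length_cons] at hlen
            omega
      refine (card_le_card hcover).trans (card_biUnion_le.trans ?_)
      calc ∑ p ∈ Adm, #({[p]} ∪ ((codes M).filter fun c' =>
            (swDec x' P r v₀ c' l (K ∪ p.1) (B ∪ p.2)
              (Z ∪ univ.filter fun v : Fin n => ∃ e ∈ p.1, v ∈ (e : Sym2 (Fin n)))).isSome = true).image
                (fun c' => p :: c'))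
          ≤ ∑ _p ∈ Adm, (1 + (2 * (P + 1) ^ (2 * r)) ^ M) := by
            refine sum_le_sum fun p _ => (card_union_le _ _).trans (add_le_add (by simp) ?_)
            exact card_image_le.trans (ih M _ _ _)
        _ = #Adm * (1 + (2 * (P + 1) ^ (2 * r)) ^ M) := by rw [sum_const, smul_eq_mul]
        _ ≤ (P + 1) ^ (2 * r) * (2 * (2 * (P + 1) ^ (2 * r)) ^ M) := by
            refine Nat.mul_le_mul ?_ ?_
            · by_cases hSP : #S ≤ P
              · exact switch_card_entries_le S P r hSP
              · rw [Finset.card_eq_zero.2]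
                · exact Nat.zero_le _
                rw [hAdm, filter_eq_empty_iff]
                rintro p - ⟨-, -, hSP', -⟩
                exact hSP hSP'
            · have : 1 ≤ (2 * (P + 1) ^ (2 * r)) ^ M := Nat.one_le_pow _ _ (by positivity)
              omega
        _ = (2 * (P + 1) ^ (2 * r)) ^ (M + 1) := by ring

/-- Registered stub `stub_switchCount` of the clique-restriction switching line (the subset count controlling the
admissible entries of a code). [folklore] -/
theorem stub_switchCount :
    ∀ (Z : Finset ℕ) (r : ℕ), (Z.powerset.filter fun T => T.card ≤ r).card ≤ (Z.card + 1) ^ r :=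
  fun Z r => switch_card_filter_powersetZ_card_le Z r

end Summit.PneNP.PneNP.Theorems
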